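import Summits.QuantumFields.GaugeBoot.DiagonalRPTorusRestTruncated
import Summits.QuantumFields.GaugeBoot.DiagonalRPTorusRestFarPairs
import HarnessLib

/-!
# Reduction of the uniform window to the near pair (gauge-boot, L3 `d = 3` uniform window, brick 5)

HONEST FRAMING (cell `pub-gaugeboot`, page 1 of every file): the venture produces certified bounds
on lattice expectations at stated coupling, gauge group, dimension and torus size; NOT a mass gap,
NOT a continuum limit, NOT a string tension; NOT Yang–Mills-summit-bearing (barriers
`FixedCouplingUltralocality`, `PerturbativeInvisibility`). This module assembles bricks 2–4 of the
uniform-in-`L` programme for the torus diagonal-RP negatives (`DiagonalRPTorusRestClustering`,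
`DiagonalRPTorusRestTruncated`, `DiagonalRPTorusRestFarPairs`); it discharges nothing by itself
and proves NO window: it isolates the one estimate that is missing (the near pair).

## Content (torus `(ℤ/L)^d`, mirror `y_i = y_j`, threshold `h`, compact metrisable `G`,
## continuous `ρ`)

Let `O` be a bounded measurable real observable reading a set `E` of links based within torus
sup-distance `r₀` of a site `y₀`, and `a` a translation vector inside the layers (`δ(a) = 0`);
`Θ = configDiagSwap i j`, `τ = siteTranslate a`, `κ` the truncated rest correlation.

* `restTrunc_comp_configDiagSwap_comm`: `κ(F∘Θ, H) = κ(H∘Θ, F)` (the two cross terms of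
  `trickForm_sub_eq` coincide).
* supports: `O∘Θ` reads `θ(E)` near `θy₀`, `O∘τ` reads `E + a` near `y₀ + a`
  (`dependsOn_comp_configDiagSwap`, `dependsOn_comp_siteTranslate`; `tsd` is invariant under `θ`
  and under translations); the DIAGONAL pairs `(O∘Θ, O)` and `(O∘τ∘Θ, O∘τ)` have their supports
  at torus distance `cyc δ(y₀)` (`tsd_siteDiagSwap`), disjoint as soon as `2r₀ < cyc δ(y₀)`.
* ★★ **`trickForm_sub_translate_le`** — for `0 ≤ β ≤ r < betaOne d ρ` and `2r₀ < cyc δ(y₀)`: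

  `trickForm (O - O∘τ) ≤ restZ · (2·K·(β/r)^{cyc δ(y₀) - (2r₀ + 2)} - 2·κ(O∘Θ, O∘τ))`,
  `K = 2 C² κ₀^{2·#E·2^d d²}`, `κ₀ = 2e^{1/2}` — every constant independent of `L`.

  For the lane's witnesses `y₀` lies on the inner top layer `δ = L/2 - 1`, so the exponent is
  `L/2 - O(1)`: UNIFORMLY in `L ≥ L₀` the sign of the trick form is decided by the NEAR PAIR
  `κ(O∘Θ, O∘τ)`, whose uniform lower bound `≥ s β^m` is the remaining crux
  (`HOME/pub-gaugeboot-lean3/gen46/D3-UNIFORM-PLAN.md` §2: the order-`m` jet + Schwarz lemma;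
  `m = 8` tubes in `d ≥ 4`, `m = 10` annuli of the bent hexagons in `d = 3`).
* `trickForm_sub_translate_neg`: the sign statement packaged (`κ_near ≥ s`, `K (β/r)^n < s` ⇒
  `trickForm < 0`), ready for `DiagRPTube.not_innerDiagonalRP_of_trickForm_neg`.

Elementary given bricks 2–4; no named fact.
-/

open MeasureTheory Finset Function

namespace Summit.QuantumFields.GaugeBoot

open Literature.MathematicalPhysics.QuantumFieldTheory

noncomputable section

namespace DiagRPUnif

open DiagRPTube

/-! ## Geometry of the swapped and translated supports -/

section Supports

variable {d L : ℕ} {G : Type*} {i j : Fin d}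

/-- `O∘Θ` reads the `θ`-image of the links read by `O`. -/
theorem dependsOn_comp_configDiagSwap {α : Type*} {O : GaugeConfig d L G → α}
    {E : Finset (Edge d L)}
    (hO : DependsOn O (E : Set (Edge d L))) :
    DependsOn (fun U => O (configDiagSwap i j U))
      ((E.image (edgeDiagSwap i j) : Finset (Edge d L)) : Set (Edge d L)) :=
  fun _ _ h => hO fun e he => h (edgeDiagSwap i j e) (mem_coe.2 (mem_image_of_mem _ (mem_coe.1 he)))

/-- `O∘τ_a` reads the translates of the links read by `O`. -/
theorem dependsOn_comp_siteTranslate {α : Type*} {O : GaugeConfig d L G → α}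
    {E : Finset (Edge d L)}
    (hO : DependsOn O (E : Set (Edge d L))) (a : Site d L) :
    DependsOn (fun U : GaugeConfig d L G => O (U.siteTranslate a))
      ((E.image fun e => (e.1 + a, e.2) : Finset (Edge d L)) : Set (Edge d L)) :=
  fun _ _ h => hO fun e he => h (e.1 + a, e.2) (mem_coe.2 (mem_image_of_mem _ (mem_coe.1 he)))

/-- `θ` is an isometry of the torus sup-distance. -/
theorem tsd_siteDiagSwap_siteDiagSwap (x y : Site d L) :
    tsd (siteDiagSwap i j x) (siteDiagSwap i j y) = tsd x y := by
  refine le_antisymm (tsd_le_of_forall fun k => ?_) (tsd_le_of_forall fun k => ?_)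
  · exact cyc_apply_le_tsd x y (Equiv.swap i j k)
  · have h := cyc_apply_le_tsd (siteDiagSwap i j x) (siteDiagSwap i j y) (Equiv.swap i j k)
    simpa only [siteDiagSwap, Equiv.swap_apply_self] using h

/-- Translations are isometries of the torus sup-distance. -/
theorem tsd_add_right (x y a : Site d L) : tsd (x + a) (y + a) = tsd x y := by
  unfold tsd
  congr 1
  funext k
  simp only [Pi.add_apply, add_sub_add_right_eq_sub]

/-- The `θ`-image of a support near `y₀` is near `θy₀`. -/
theorem tsd_le_of_mem_image_edgeDiagSwap {E : Finset (Edge d L)} {y₀ : Site d L} {r₀ : ℕ}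
    (hE : ∀ e ∈ E, tsd y₀ e.1 ≤ r₀) :
    ∀ e ∈ E.image (edgeDiagSwap i j), tsd (siteDiagSwap i j y₀) e.1 ≤ r₀ := by
  intro e he
  obtain ⟨e', he', rfl⟩ := mem_image.1 he
  rw [edgeDiagSwap, tsd_siteDiagSwap_siteDiagSwap]
  exact hE e' he'

/-- The translate of a support near `y₀` is near `y₀ + a`. -/
theorem tsd_le_of_mem_image_translate {E : Finset (Edge d L)} {y₀ : Site d L} {r₀ : ℕ}
    (hE : ∀ e ∈ E, tsd y₀ e.1 ≤ r₀) (a : Site d L) :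
    ∀ e ∈ E.image (fun e => (e.1 + a, e.2)), tsd (y₀ + a) e.1 ≤ r₀ := by
  intro e he
  obtain ⟨e', he', rfl⟩ := mem_image.1 he
  rw [tsd_add_right]
  exact hE e' he'

/-- **Far supports are disjoint**: two link sets based within `r₁` of `y₁` and `r₂` of `y₂` with
`r₁ + r₂ < tsd y₁ y₂` share no link. -/
theorem disjoint_of_far [NeZero L] {E₁ E₂ : Finset (Edge d L)} {y₁ y₂ : Site d L} {r₁ r₂ : ℕ}
    (hE₁ : ∀ e ∈ E₁, tsd y₁ e.1 ≤ r₁) (hE₂ : ∀ e ∈ E₂, tsd y₂ e.1 ≤ r₂)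
    (hfar : r₁ + r₂ < tsd y₁ y₂) : Disjoint E₁ E₂ := by
  rw [Finset.disjoint_left]
  intro e h1 h2
  have h := tsd_triangle y₁ e.1 y₂
  rw [tsd_comm e.1 y₂] at h
  have := hE₁ e h1
  have := hE₂ e h2
  omega

end Supports

/-! ## The reduction -/

section Reduction

variable {d L : ℕ} [NeZero L] {N : ℕ} {G : Type*} [Group G] [TopologicalSpace G]
  [IsTopologicalGroup G] [CompactSpace G] [MeasurableSpace G] [BorelSpace G]
  [SecondCountableTopology G] (ρ : G →* Matrix (Fin N) (Fin N) ℂ) (β : ℝ) (i j : Fin d) (h : ℕ)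

omit [SecondCountableTopology G] in
/-- **The two cross terms coincide**: `κ(F∘Θ, H) = κ(H∘Θ, F)` (`Θ`-invariance of the rest
measure, `Θ` an involution). -/
theorem restTrunc_comp_configDiagSwap_comm (hρ : Continuous ρ) (F H : GaugeConfig d L G → ℝ) :
    restTrunc ρ β (restPlaqs i j h) (fun U => F (configDiagSwap i j U)) H =
      restTrunc ρ β (restPlaqs i j h) (fun U => H (configDiagSwap i j U)) F := by
  unfold restTrunc
  rw [restExpect_comp_configDiagSwap ρ β i j h hρ F, restExpect_comp_configDiagSwap ρ β i j h hρ H,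
    ← restExpect_comp_configDiagSwap ρ β i j h hρ (fun U => F (configDiagSwap i j U) * H U)]
  simp only [configDiagSwap_configDiagSwap]
  rw [mul_comm (restExpect ρ β _ F)]
  congr 1
  exact congrArg _ (funext fun U => mul_comm _ _)

/-- ★★ **REDUCTION TO THE NEAR PAIR.** Let `O` be bounded measurable, reading links based within
`r₀` of `y₀`, `a` a translation inside the layers, `2r₀ < cyc δ(y₀)` and `0 ≤ β ≤ r < betaOne d ρ`.
Then `trickForm (O - O∘τ_a) ≤ restZ · (2 K (β/r)^{cyc δ(y₀) - (2r₀+2)} - 2 κ(O∘Θ, O∘τ_a))` with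
`K = 2 C² κ₀^{2·#E·2^d d²}`: uniformly in `L`, the two diagonal pairs are exponentially small in
the distance `cyc δ(y₀)` to the mirror image, and the near pair decides. -/
theorem trickForm_sub_translate_le (hρ : Continuous ρ) {O : GaugeConfig d L G → ℝ}
    (hOm : Measurable O) {C : ℝ} (hOb : ∀ U, |O U| ≤ C) {E : Finset (Edge d L)}
    (hOE : DependsOn O (E : Set (Edge d L))) {y₀ : Site d L} {r₀ : ℕ}
    (hE : ∀ e ∈ E, tsd y₀ e.1 ≤ r₀) {a : Site d L} (ha : lay i j a = 0)
    (hfar : 2 * r₀ < cyc (lay i j y₀)) {r : ℝ} (hr : 0 < r) (hrR : r < betaOne d ρ) (hβ0 : 0 ≤ β)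
    (hβr : β ≤ r) :
    trickForm ρ i j h β (fun U : GaugeConfig d L G => O U - O (U.siteTranslate a)) ≤
      restZ ρ β (restPlaqs (L := L) i j h) *
        (2 * (2 * C * C * (2 * Real.exp (1 / 2)) ^ ((E.card + E.card) * (2 ^ d * (d * d))) *
            (β / r) ^ (cyc (lay i j y₀) - (r₀ + r₀ + 2))) -
          2 * restTrunc ρ β (restPlaqs i j h) (fun U => O (configDiagSwap i j U))
            (fun U : GaugeConfig d L G => O (U.siteTranslate a))) := by
  rw [trickForm_sub_translate_eq ρ β i j h hρ hOm hOb ha]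
  refine mul_le_mul_of_nonneg_left ?_ (restZ_pos ρ β hρ _).le
  set K : ℝ := 2 * C * C * (2 * Real.exp (1 / 2)) ^ ((E.card + E.card) * (2 ^ d * (d * d))) *
    (β / r) ^ (cyc (lay i j y₀) - (r₀ + r₀ + 2)) with hK
  -- the translated observable and the two swapped observables
  set Oτ : GaugeConfig d L G → ℝ := fun U => O (U.siteTranslate a) with hOτ
  have hOτm : Measurable Oτ := measurable_comp_siteTranslate a hOm
  have hOτb : ∀ U, |Oτ U| ≤ C := fun U => hOb _
  have hOτE :
      DependsOn Oτ ((E.image fun e => (e.1 + a, e.2) : Finset (Edge d L)) : Set (Edge d L)) :=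
    dependsOn_comp_siteTranslate hOE a
  -- first diagonal pair `(O∘Θ, O)`
  have h11 : |restTrunc ρ β (restPlaqs i j h) (fun U => O (configDiagSwap i j U)) O| ≤ K := by
    have hfar' : r₀ + r₀ < tsd (siteDiagSwap i j y₀) y₀ := by
      rw [tsd_comm, tsd_siteDiagSwap (fun hij => ?_) y₀]
      · omega
      · rw [hij, lay, sub_self, cyc_zero] at hfar; exact Nat.not_lt_zero _ hfar
    have hb := abs_restTrunc_le_of_far ρ β hρ (restPlaqs i j h)
      (measurable_comp_configDiagSwap i j hOm) hOm (fun U => hOb _) hOb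
      (dependsOn_comp_configDiagSwap hOE) hOE
      (disjoint_of_far (tsd_le_of_mem_image_edgeDiagSwap hE) hE hfar')
      (tsd_le_of_mem_image_edgeDiagSwap hE) hE hr hrR hβ0 hβr
    rw [card_image_of_injective _
      (Function.Involutive.injective (edgeDiagSwap_edgeDiagSwap i j)), tsd_comm,
      tsd_siteDiagSwap, ] at hb
    · exact hb
    · intro hij; rw [hij, lay, sub_self, cyc_zero] at hfar; exact Nat.not_lt_zero _ hfar
  -- second diagonal pair `(Oτ∘Θ, Oτ)`
  have h22 : |restTrunc ρ β (restPlaqs i j h) (fun U => Oτ (configDiagSwap i j U)) Oτ| ≤ K := by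
    have hlay : lay i j (y₀ + a) = lay i j y₀ := by rw [lay_add, ha, add_zero]
    have hij : i ≠ j := by
      intro hij; rw [hij, lay, sub_self, cyc_zero] at hfar; exact Nat.not_lt_zero _ hfar
    have hfar' : r₀ + r₀ < tsd (siteDiagSwap i j (y₀ + a)) (y₀ + a) := by
      rw [tsd_comm, tsd_siteDiagSwap hij, hlay]; omega
    have hEτ := tsd_le_of_mem_image_translate hE a
    have hb := abs_restTrunc_le_of_far ρ β hρ (restPlaqs i j h)
      (measurable_comp_configDiagSwap i j hOτm) hOτm (fun U => hOτb _) hOτb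
      (dependsOn_comp_configDiagSwap hOτE) hOτE
      (disjoint_of_far (tsd_le_of_mem_image_edgeDiagSwap hEτ) hEτ hfar')
      (tsd_le_of_mem_image_edgeDiagSwap hEτ) hEτ hr hrR hβ0 hβr
    rw [card_image_of_injective _
      (Function.Involutive.injective (edgeDiagSwap_edgeDiagSwap i j)), tsd_comm,
      tsd_siteDiagSwap hij, hlay] at hb
    refine hb.trans (le_of_eq ?_)
    rw [hK]
    have hcard : (E.image fun e : Edge d L => (e.1 + a, e.2)).card = E.card :=
      card_image_of_injective _ fun e e' hee' => by
        simpa [Prod.ext_iff, add_left_inj] using hee'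
    rw [hcard]
  -- the two cross terms coincide
  have hcross : restTrunc ρ β (restPlaqs i j h) (fun U => Oτ (configDiagSwap i j U)) O =
      restTrunc ρ β (restPlaqs i j h) (fun U => O (configDiagSwap i j U)) Oτ :=
    restTrunc_comp_configDiagSwap_comm ρ β i j h hρ Oτ O
  rw [hcross]
  have e11 := (abs_le.1 h11).2
  have e22 := (abs_le.1 h22).2
  linarith

/-- ★ **The sign statement.** Under the hypotheses of `trickForm_sub_translate_le`, a uniform
lower bound `s` on the near-pair truncated correlation `κ(O∘Θ, O∘τ_a)` beating the far-pair bound,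
`2 C² κ₀^{2·#E·2^d d²} (β/r)^{cyc δ(y₀) - (2r₀+2)} < s`, makes the trick form NEGATIVE (feed
`DiagRPTube.not_innerDiagonalRP_of_trickForm_neg` /
`not_diagonalReflectionPositive_of_trickForm_neg`). -/
theorem trickForm_sub_translate_neg (hρ : Continuous ρ) {O : GaugeConfig d L G → ℝ}
    (hOm : Measurable O) {C : ℝ} (hOb : ∀ U, |O U| ≤ C) {E : Finset (Edge d L)}
    (hOE : DependsOn O (E : Set (Edge d L))) {y₀ : Site d L} {r₀ : ℕ}
    (hE : ∀ e ∈ E, tsd y₀ e.1 ≤ r₀) {a : Site d L} (ha : lay i j a = 0)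
    (hfar : 2 * r₀ < cyc (lay i j y₀)) {r : ℝ} (hr : 0 < r) (hrR : r < betaOne d ρ) (hβ0 : 0 ≤ β)
    (hβr : β ≤ r) {s : ℝ}
    (hnear : s ≤ restTrunc ρ β (restPlaqs i j h) (fun U => O (configDiagSwap i j U))
      (fun U : GaugeConfig d L G => O (U.siteTranslate a)))
    (hwin : 2 * C * C * (2 * Real.exp (1 / 2)) ^ ((E.card + E.card) * (2 ^ d * (d * d))) *
      (β / r) ^ (cyc (lay i j y₀) - (r₀ + r₀ + 2)) < s) :
    trickForm ρ i j h β (fun U : GaugeConfig d L G => O U - O (U.siteTranslate a)) < 0 := by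
  have hle := trickForm_sub_translate_le ρ β i j h hρ hOm hOb hOE hE ha hfar hr hrR hβ0 hβr
  have hZ := restZ_pos ρ β hρ (restPlaqs (L := L) i j h)
  have hneg : 2 * (2 * C * C * (2 * Real.exp (1 / 2)) ^ ((E.card + E.card) * (2 ^ d * (d * d))) *
      (β / r) ^ (cyc (lay i j y₀) - (r₀ + r₀ + 2))) -
      2 * restTrunc ρ β (restPlaqs i j h) (fun U => O (configDiagSwap i j U))
        (fun U : GaugeConfig d L G => O (U.siteTranslate a)) < 0 := by linarith
  exact hle.trans_lt (by nlinarith)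

end Reduction

end DiagRPUnif

end

end Summit.QuantumFields.GaugeBoot
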